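import Summits.ResolutionOfSingularities.ResolutionOfSingularities.Theorems.SandwichedSingularitiesResolution
import Summits.ResolutionOfSingularities.ResolutionOfSingularities.Theorems.ValuativePatchingRelBlowupExtension
import Summits.ResolutionOfSingularities.ResolutionOfSingularities.Theorems.ValuativePatchingRelStrongBlowup
import Summits.ResolutionOfSingularities.ResolutionOfSingularities.Theorems.ValuativePatchingRelProjTwoModelPatching
import Summits.ResolutionOfSingularities.ResolutionOfSingularities.Theses.Valuative
import Summits.ResolutionOfSingularities.ResolutionOfSingularities.Theses.CyclicCovers
import Literature.AlgebraicGeometry.Resolution.ProperModelsRegLeification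
import Literature.AlgebraicGeometry.Resolution.CompletedPullbackRegular
import Literature.AlgebraicGeometry.Resolution.CanonicalResolutionProofs
import Literature.AlgebraicGeometry.Resolution.ProjectiveModelsModification
import Literature.AlgebraicGeometry.Resolution.ProjectiveModelsJoin
import Literature.AlgebraicGeometry.Resolution.ZariskiPatchingAllDimensions
import Literature.AlgebraicGeometry.Resolution.RegularCentreBlowupSeqExtension
import Literature.AlgebraicGeometry.Resolution.SandwichedWeakPatching
import Literature.AlgebraicGeometry.Resolution.RegularLocusDense
import HarnessLib

/-!
# Crux `PatchingRel` (stmt-ResolutionOfSingularities-0642), line `sandwiched-gluing` (v3 cut):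
# the QUASI-PROJECTIVE branch — Zariski patching with projective models from the blow-up atom
# for quasi-projective varieties only

The v3 atoms SANDᵇ / SAND⁺ᵇ ask for resolution BY ONE BLOWING UP of an arbitrary (separated,
finite type) variety with sandwiched singular locus. For QUASI-PROJECTIVE varieties that format
is exactly the format of the literature ("a resolution `X' → X` with `X' → X` projective": a
projective birational morphism of integral schemes onto a scheme quasi-projective over an affine
Noetherian base is a blowing up, Liu 2002, Thm. 8.1.24 = Hartshorne II.7.17), whereas for
non-quasi-projective varieties it is formally stronger (refuter drefute g4, 12:33Z). This file
runs the whole line with PROJECTIVE models (`ProjModel`; the tree's resolving-system theorem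
`resolutionInChar_of_twoModelPatching_of_relLU` is stated for them), so that only the
quasi-projective atoms `SandwichedBlowupResolutionQProj` / `SandwichedStrongBlowupResolutionQProj`
are consumed:

* `projRegLeification_of_sandwichedBlowupQProj` (registered stub
  `stub_projRegLeification_of_sandwichedBlowupQProj`, QP1) — **SANDᵇ_qp(p) ⇒ RegLe-ification of
  one morphism of projective models**: for `φ : M → Y`, the sandwiched-singularity open
  `O := φ⁻¹(Reg Y) ∪ Reg M` of the projective model `M` is quasi-projective (`O ↪ M ↪ ℙⁿ`); the
  atom gives a blowing up `Bl_I O` with regular source; the extended blowing up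
  `Bl_{I.map O.ι} M → M` (`exists_isPullback_of_isBlowup_opens`) is projective over `k`
  (`IsBlowup.isProjectiveOver`), hence a projective model dominating `M`
  (`ProjModel.exists_projModel_of_isBirational`), regular over `O`;
* `sandwichedBlowupResolutionQProj_of_strongQProj` (stub
  `stub_sandwichedBlowupQProj_of_strongQProj`, QP3) — SAND⁺ᵇ_qp ⇒ SANDᵇ_qp (an open of a
  quasi-projective scheme is quasi-projective; then `exists_isBlowup_of_isBlowup_opens_of_regular_off`);
* `patchingRel_of_sandwichedBlowupQProj` (registered capstone) and
  `patchingRel_of_sandwichedStrongBlowupQProj` — **the crux from the quasi-projective atoms**,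
  via `projTwoModelPatching_of_projRegLeification` (QP2) and
  `resolutionInChar_of_twoModelPatching_of_relLU`; NO named-fact hypothesis.

## References

* O. Piltant, *An axiomatic version of Zariski's patching theorem*, RACSAM 107 (2013) 91–121,
  Prop. 5.1 (proof, Steps 2 and 4: the blowing ups are again projective models). [Piltant2013]
* Q. Liu, *Algebraic Geometry and Arithmetic Curves*, OUP 2002, Thm. 8.1.24. [Liu2002]
-/

-- `Summit.<Summit>.<Sub>.Theorems` with `Sub = Summit` (single-conjunct summit, D-0017): the
-- duplicated namespace component is the tree layout.
set_option linter.dupNamespace false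

noncomputable section

namespace Summit.ResolutionOfSingularities.ResolutionOfSingularities.Theorems

open CategoryTheory AlgebraicGeometry TopologicalSpace
open Literature.AlgebraicGeometry.Resolution Literature.AlgebraicGeometry.Motives

universe u

/-- **SAND⁺ᵇ_qp(p) ⇒ SANDᵇ_qp(p)**: the sandwiched piece `V` of a quasi-projective `X` is
quasi-projective (compose the open immersions), so the strong quasi-projective atom applies to it,
and a Sing-admissible blowing up of `V` extends to `X`
(`exists_isBlowup_of_isBlowup_opens_of_regular_off`). [cite: Piltant2013, Prop. 5.1 (proof, Step 2)] -/
theorem sandwichedBlowupResolutionQProj_of_strong {p : ℕ}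
    (hS : SandwichedStrongBlowupResolutionQProj.{u} p) : SandwichedBlowupResolutionQProj.{u} p := by
  intro k _ _ U X f g V η hf₁ hf₂ hf₃ hU hUreg hg₁ hg₂ hg₃ hX hη hbir hcompat hout hqp
  haveI := hf₁; haveI := hf₂; haveI := hf₃; haveI := hU; haveI := hg₁; haveI := hg₂
  haveI := hg₃; haveI := hX; haveI := hη
  haveI : IsLocallyNoetherian X := LocallyOfFiniteType.isLocallyNoetherian g
  by_cases hVne : (V : Set X).Nonempty
  swap
  · refine ⟨⊤, X, 𝟙 X, ?_, isBlowup_id_top X, fun x => hout x fun hx => hVne ⟨x, hx⟩⟩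
    intro h
    have h1 : ((⊤ : X.IdealSheafData).support : Set X) = Set.univ := by
      rw [h, Scheme.IdealSheafData.support_bot]; rfl
    rw [Scheme.IdealSheafData.support_top] at h1
    exact (Set.univ_nonempty.ne_empty h1.symm).elim
  haveI : Nonempty (V : Scheme.{u}) := by
    obtain ⟨x, hx⟩ := hVne
    exact ⟨⟨x, hx⟩⟩
  haveI : IsIntegral (V : Scheme.{u}) := isIntegral_of_isOpenImmersion V.ι
  -- `V` is quasi-projective: compose the open immersions
  have hqpV : ∃ (P : Scheme.{u}) (πP : P ⟶ Spec (.of k)) (j : (V : Scheme.{u}) ⟶ P),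
      IsProjectiveOver (Over.mk πP) ∧ IsOpenImmersion j ∧ j ≫ πP = η ≫ f := by
    obtain ⟨P, πP, j, hP, hj, hjπ⟩ := hqp
    haveI := hj
    refine ⟨P, πP, V.ι ≫ j, hP, inferInstance, ?_⟩
    rw [Category.assoc, hjπ, hcompat]
  obtain ⟨J, V', π, hJ, hJsing, hπ, hreg⟩ :=
    hS k U (V : Scheme.{u}) f η inferInstance inferInstance inferInstance inferInstance hUreg
      inferInstance hη hbir hqpV
  obtain ⟨I, X', ρ, hI, -, hρ, hreg'⟩ :=
    exists_isBlowup_of_isBlowup_opens_of_regular_off g V hout hJ hJsing hπ hreg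
  exact ⟨I, X', ρ, hI, hρ, hreg'⟩

/-- **Registered stub QP3** (universe `0`): SAND⁺ᵇ_qp(p) ⇒ SANDᵇ_qp(p). [folklore] -/
theorem stub_sandwichedBlowupQProj_of_strongQProj :
    ∀ p : ℕ, SandwichedStrongBlowupResolutionQProj.{0} p → SandwichedBlowupResolutionQProj.{0} p :=
  fun _ hS => sandwichedBlowupResolutionQProj_of_strong hS

/-- **SANDᵇ_qp(p) ⇒ RegLe-ification of one morphism of PROJECTIVE models** (Piltant 2013,
proof of Prop. 5.1, Steps 2 and 4, with the resolution input in blow-up format): for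
`φ : M → Y` a morphism of projective models of `K/k` (`char k = p`), the open
`O := φ⁻¹(Reg Y) ∪ Reg M` of `M` is quasi-projective and regular off `φ⁻¹(Reg Y)`, which is
proper-birational over the regular `Reg Y`; the atom desingularises `O` by a blowing up
`Bl_I O`; the blowing up of `M` along `I.map O.ι` is projective over `k`, hence a projective model
`ψ : M' → M`, and it is regular over `O`, i.e. `ψ⁻¹(Reg M) ⊆ Reg M'` and
`(φψ)⁻¹(Reg Y) ⊆ Reg M'`. No gluing, no compactification. [cite: Piltant2013, Prop. 5.1 (proof, Steps 2 and 4)] -/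
theorem projRegLeification_of_sandwichedBlowupQProj {p : ℕ}
    (hS : SandwichedBlowupResolutionQProj.{u} p) {k : Type u} [Field k] [CharP k p]
    {K : Type u} [Field K] [Algebra k K] (M Y : ProjModel k K) (φ : M.Hom Y) :
    ∃ (M' : ProjModel k K) (ψ : M'.Hom M), ψ.RegLe ∧ (ψ.comp φ).RegLe := by
  let UY : Y.X.Opens :=
    ⟨Scheme.regularLocus Y.X, isOpen_regularLocus_of_locallyOfFiniteType_field Y.π⟩
  let RM : M.X.Opens :=
    ⟨Scheme.regularLocus M.X, isOpen_regularLocus_of_locallyOfFiniteType_field M.π⟩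
  let V : M.X.Opens := φ.f ⁻¹ᵁ UY
  let O : M.X.Opens := V ⊔ RM
  have hVO : V ≤ O := le_sup_left
  have hgenY : genericPoint Y.X ∈ UY := by
    show genericPoint Y.X ∈ Scheme.regularLocus Y.X
    apply Scheme.genericPoints_subset_regularLocus
    rw [genericPoints_eq_singleton]
    rfl
  haveI : Nonempty (UY : Scheme.{u}) := ⟨⟨_, hgenY⟩⟩
  haveI : IsIntegral (UY : Scheme.{u}) := isIntegral_of_isOpenImmersion UY.ι
  have hUreg : Scheme.IsRegular (UY : Scheme.{u}) := fun u =>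
    (isRegularLocalRing_stalk_iff_of_isOpenImmersion UY.ι u).mp u.2
  have hcompat : (φ.f ∣_ UY) ≫ (UY.ι ≫ Y.π) = V.ι ≫ M.π := by
    rw [morphismRestrict_ι_assoc, φ.f_π]
  have hout : ∀ x : M.X, x ∈ O → x ∉ V → IsRegularLocalRing (M.X.presheaf.stalk x) := by
    intro x hx hxV
    rcases Opens.mem_sup.mp hx with h | h
    · exact absurd h hxV
    · exact h
  -- `O` is non-empty (it contains the generic point of `M`, which lies over that of `Y`)
  have hgenM : genericPoint M.X ∈ RM := by
    show genericPoint M.X ∈ Scheme.regularLocus M.X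
    apply Scheme.genericPoints_subset_regularLocus
    rw [genericPoints_eq_singleton]
    rfl
  have hOne : (O : Set M.X).Nonempty := ⟨_, Opens.mem_sup.mpr (Or.inr hgenM)⟩
  haveI : Nonempty (O : Scheme.{u}) := hOne.to_subtype
  haveI : IsIntegral (O : Scheme.{u}) := isIntegral_of_isOpenImmersion O.ι
  -- the sandwiched piece of `O`: `V' := O ∩ V ≅ V`
  let V' : (O : Scheme.{u}).Opens := O.ι ⁻¹ᵁ V
  let e : (V' : Scheme.{u}) ≅ (V : Scheme.{u}) := Scheme.Opens.isoOfLE hVO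
  let η' : (V' : Scheme.{u}) ⟶ (UY : Scheme.{u}) := e.hom ≫ (φ.f ∣_ UY)
  have hη'proper : IsProper η' := inferInstance
  have hη'bir : IsBirational η' :=
    (isBirational_of_isIso e.hom).comp (φ.isBirational.morphismRestrict UY)
  have hη'compat : η' ≫ (UY.ι ≫ Y.π) = V'.ι ≫ (O.ι ≫ M.π) := by
    show (e.hom ≫ (φ.f ∣_ UY)) ≫ (UY.ι ≫ Y.π) = V'.ι ≫ (O.ι ≫ M.π)
    rw [Category.assoc, hcompat, ← Category.assoc, Scheme.Opens.isoOfLE_hom_ι, Category.assoc]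
  have hout' : ∀ x : (O : Scheme.{u}), x ∉ V' →
      IsRegularLocalRing ((O : Scheme.{u}).presheaf.stalk x) := fun x hx =>
    (isRegularLocalRing_stalk_iff_of_isOpenImmersion O.ι x).mp (hout x.1 x.2 hx)
  -- `O` is quasi-projective: `O ↪ M ↪ ℙⁿ`
  have hqp : ∃ (P : Scheme.{u}) (πP : P ⟶ Spec (.of k)) (j : (O : Scheme.{u}) ⟶ P),
      IsProjectiveOver (Over.mk πP) ∧ IsOpenImmersion j ∧ j ≫ πP = O.ι ≫ M.π :=
    ⟨M.X, M.π, O.ι, M.isProjectiveOver, inferInstance, rfl⟩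
  -- the atom on `O`
  obtain ⟨I, N₀, π, hI, hπ, hreg⟩ := hS k (UY : Scheme.{u}) (O : Scheme.{u}) (UY.ι ≫ Y.π)
    (O.ι ≫ M.π) V' η' inferInstance inferInstance inferInstance inferInstance hUreg
    inferInstance inferInstance inferInstance inferInstance hη'proper hη'bir hη'compat hout' hqp
  -- extend the blowing up to `M`: a PROJECTIVE modification
  obtain ⟨Z, ρ, s, hZ, hρ, hbir, hs, hsq, hblow⟩ := exists_isPullback_of_isBlowup_opens O hI hπ
  haveI := hZ
  haveI := hρ
  haveI := hs
  have hproj : IsProjectiveOver (Over.mk (ρ ≫ M.π) : SchemeOver k) :=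
    hblow.isProjectiveOver M.π M.isProjectiveOver
  have hregO : ∀ z : Z, ρ z ∈ O → IsRegularLocalRing (Z.presheaf.stalk z) := fun z hz =>
    isRegularLocalRing_stalk_of_isPullback_ι hsq (S := (O : Set M.X)) le_rfl
      (fun m _ => hreg m) z hz
  obtain ⟨M', ψ, e', hψ⟩ := M.exists_projModel_of_isBirational ρ hbir hproj
  subst e'
  rw [eqToHom_refl, Category.id_comp] at hψ
  refine ⟨M', ψ, fun y hy => ?_, fun y hy => ?_⟩
  · rw [hψ] at hy
    have := hregO y (Opens.mem_sup.mpr (Or.inr hy))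
    simpa [hψ] using this
  · rw [ProjModel.Hom.comp_f, Scheme.Hom.comp_apply, hψ] at hy
    have := hregO y (hVO (show φ.f (ρ y) ∈ UY from hy))
    simpa [hψ] using this

/-- **Registered stub QP1** (universe `0`): SANDᵇ_qp(p) ⇒ RegLe-ification of projective models.
[cite: Piltant2013, Prop. 5.1 (proof, Steps 2 and 4)] -/
theorem stub_projRegLeification_of_sandwichedBlowupQProj :
    ∀ p : ℕ, SandwichedBlowupResolutionQProj.{0} p → ∀ (k : Type) [Field k] [CharP k p]
      (K : Type) [Field K] [Algebra k K] (M Y : Literature.AlgebraicGeometry.Resolution.ProjModel k K)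
      (φ : M.Hom Y), ∃ (M1 : Literature.AlgebraicGeometry.Resolution.ProjModel k K) (ψ : M1.Hom M),
        ψ.RegLe ∧ (ψ.comp φ).RegLe :=
  fun _ hS _ _ _ _ _ _ M Y φ => projRegLeification_of_sandwichedBlowupQProj hS M Y φ

/-- Per-prime slice: SANDᵇ_qp(p) and relative local uniformization give `ResolutionInChar.{0} p`,
with PROJECTIVE models throughout (RegLe-ification ⇒ two-model patching by
`projTwoModelPatching_of_projRegLeification`, then the resolving system
`resolutionInChar_of_twoModelPatching_of_relLU`). [cite: Piltant2013, Prop. 5.1 and Cor. 5.7] -/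
theorem resolutionInChar_of_sandwichedBlowupQProj_of_lurel (p : ℕ)
    (hS : SandwichedBlowupResolutionQProj.{0} p)
    (hLU : ∀ (k K : Type) [Field k] [CharP k p] [Field K] [Algebra k K],
      (⊤ : IntermediateField k K).FG → ∀ O : ValuationSubring K,
        (∀ c : k, algebraMap k K c ∈ O) → ∀ R : Subalgebra k K, R.FG →
          R.toSubring ≤ O.toSubring →
            ∃ (A : Subalgebra k K) (h : A.toSubring ≤ O.toSubring), R ≤ A ∧ A.FG ∧
              IsFractionRing A K ∧ IsRegularLocalRing (Localization.AtPrime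
                (Ideal.comap (Subring.inclusion h) (IsLocalRing.maximalIdeal O)))) :
    ResolutionInChar.{0} p := by
  refine resolutionInChar_of_twoModelPatching_of_relLU (p := p) ?_ hLU
  intro k _ _ K _ _ _ M₁ M₂
  exact projTwoModelPatching_of_projRegLeification
    (fun M Y φ => projRegLeification_of_sandwichedBlowupQProj hS M Y φ) M₁ M₂

/-- **Crux `PatchingRel` from the QUASI-PROJECTIVE blow-up atom** (registered capstone
`patchingRel_of_sandwichedBlowupQProj`; NO named-fact hypothesis): if every quasi-projective
variety with sandwiched singular locus, in every prime characteristic, is desingularised by one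
blowing up (= has a projective resolution, Liu 8.1.24), then relative local uniformization implies
resolution of singularities. CONDITIONAL only on the open conjecture
`SandwichedBlowupResolutionQProj`. [cite: Piltant2013, Prop. 5.1 and Cor. 5.7] -/
theorem patchingRel_of_sandwichedBlowupQProj :
    (∀ p : ℕ, p.Prime → SandwichedBlowupResolutionQProj.{0} p) →
    Summit.ResolutionOfSingularities.ResolutionOfSingularities.Theses.Valuative.PatchingRel :=
  fun hS p hp hLU => resolutionInChar_of_sandwichedBlowupQProj_of_lurel p (hS p hp) hLU

/-- The same for the `CyclicCovers` copy of the crux (the same term). [folklore] -/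
theorem cyclicCovers_patchingRel_of_sandwichedBlowupQProj :
    (∀ p : ℕ, p.Prime → SandwichedBlowupResolutionQProj.{0} p) →
    Summit.ResolutionOfSingularities.ResolutionOfSingularities.Theses.CyclicCovers.PatchingRel :=
  patchingRel_of_sandwichedBlowupQProj

/-- **Crux `PatchingRel` from Sing-admissible blow-up desingularization of QUASI-PROJECTIVE
sandwiched varieties** (the strong quasi-projective atom; = "a projective resolution which is
an isomorphism over the regular locus", the format of CJS 2020 / CP 2008–2009 / Hironaka).
CONDITIONAL only on `SandwichedStrongBlowupResolutionQProj`. [cite: Piltant2013, Prop. 5.1 and Cor. 5.7] -/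
theorem patchingRel_of_sandwichedStrongBlowupQProj :
    (∀ p : ℕ, p.Prime → SandwichedStrongBlowupResolutionQProj.{0} p) →
    Summit.ResolutionOfSingularities.ResolutionOfSingularities.Theses.Valuative.PatchingRel :=
  fun hS => patchingRel_of_sandwichedBlowupQProj fun p hp =>
    sandwichedBlowupResolutionQProj_of_strong (hS p hp)

end Summit.ResolutionOfSingularities.ResolutionOfSingularities.Theorems

end
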